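import Mathlib
import HarnessLib
import HarnessLib.Audit
import Summits.CriticalPhenomena.Statement
import HarnessLib.Audit.Status.Attr

/-!
Route: InverseSquareTelemetry

# Route InverseSquareTelemetry — eta(1+eta) is the coupling of the exact effective potential
Lap(G)/G; an inverse-square law with Dini rate plus lattice Agmon-Murata asymptotics gives the pure
power law (item 0634)

It suffices to show X_IST = (T) ∧ (A) ∧ (C), realising idea card inverse-square-telemetry (spine).
Write G := ⟨σ₀σ_x⟩⁺_{β_c(3)}
= criticalTwoPoint 3, Δ_{ℤ³}f(x) := Σ_i (f(x+e_i) + f(x−e_i)) − 6 f(x), |x| the EUCLIDEAN norm, and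
V_eff := Δ_{ℤ³}G / G — the exact
effective potential for which G is, by construction, the positive decaying solution of the lattice
Schrödinger equation Δu = V u off 0.
(T) INVERSE-SQUARE TELEMETRY [crux r2]: ∃ κ ≥ 0, ε > 0, C with | |x|²·V_eff(x) − κ | ≤ C|x|^{−ε} for
all x ≠ 0 (conjecturally
κ = η(1+η) ≈ 0.0376, ε = min(ω, 2) ≈ 0.83). (A) LATTICE AGMON–MURATA–PINCHOVER [crux r3, pure
analysis on ℤ³]: every positive
solution u of Δu = Vu on {|x| ≥ R} with | |x|²V − κ | ≤ C|x|^{−ε} (κ ≥ 0) and u → 0 satisfies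
u(x)|x|^{α₊} → c > 0, α₊ = (1+√(1+4κ))/2.
(C) TWO-POINT-SPINE COMPLEMENT [crux r4, imported]: if G(x)|x|^{2Δ} → c > 0 then the conjunct holds
with this Δ. (T)+(A) give item 0634
(IsingEuclidUpgradeR2RotInvPowerLaw: rotation-invariant pure power law, 2Δ = α₊(κ)) by a three-line
glue; (C) finishes.
Lean: `InverseSquareLaw ∧ PositiveSolutionAsymptotics ∧ TwoPointSpineComplement`

## Assembly
Pure logic (verified sorry-free in the planner's Sketch.lean, `assembly_glue`, 4 lines): from
InverseSquareLaw and PositiveSolutionAsymptotics,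
PowerLawFromTelemetry yields Δ, c > 0 with G·|x|₂^{2Δ} → c; TwoPointSpineComplement applied to (Δ,
c) yields ρ, S with 0 < Δ, the pointwise
scaling limit, non-degeneracy, Möbius covariance and U₄ ≢ 0; repackage as ⟨ρ, Δ, S, …⟩ :
Ising3DConformalLimit (root abbrev of
Summits/CriticalPhenomena/Ising3DConformalLimit/Statement =
Literature.Probability.LatticeModels.CritIsing3DConformalLimit).

Rationale: WHY THIS LINE. The card's reformulation: instead of reading the anomalous dimension off G (a log–log
slope with no structure), read it off the EXACT
EFFECTIVE POTENTIAL V_eff = ΔG/G, which by Callen's identity ⟨σ₀σ_x⟩ = ⟨σ₀ tanh(β_c S_x)⟩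
(Callen1963; the Schwinger–Dyson family of
ChoEtAl2022) is same-site odd-probe data, V_eff = (1/a₁ − 6) − (a₃r₃ + a₅r₅)/a₁ with r_k =
⟨σ₀S_x^k⟩/⟨σ₀σ_x⟩ — bounded, dimensionless,
renormalisation-free. A pure power law G ≈ A|x|^{−2Δ} forces the conformally invariant
inverse-square law |x|²V_eff → κ = 2Δ(2Δ−1) =
η(1+η) ≥ 0 (κ ≥ 0 ⟺ the unitarity bound Δ ≥ 1/2; κ = 0 ⟺ free/Coulomb), and the CONVERSE is analysis
imported from the structure theory
of positive solutions of (−Δ+V)u = 0 with Fuchsian potentials (Murata1986, Pinchover1994; on graphs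
KellerPinchoverPogorzelski2018,
KellerPinchoverPogorzelski2019, KellerPogorzelski2025; Harnack on graphs Delmotte1999,
LawlerLimic2010 §6): α₊ is the indicial root, the
Dini rate kills slowly varying factors. So the rank-2 crux 0634 of route IsingEuclidUpgrade is
converted into 'local laws near a source
converge, isotropically, at rate |x|^{−2}' — the zeroth order of which (ratio limits) is what
current mixing / the IIC deliver in d = 3
(AizenmanDuminilCopinAnnals2021 §6, Panis2025 Thm 3.1; sibling card far-field-forgets-the-probe),
the rate being the sharply posed open
piece. Areas imported: PDE/potential theory of Schrödinger operators (criticality theory,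
Agmon–Murata asymptotics), with the explicit
dictionary charge μ = (−Δ)G, potential V_eff, flux Q(R) = −Σ_{Λ_R}ΔG ≍ R^{−η} (η = screening
exponent). What prior routes do not do:
IsingEuclidUpgrade files 0634 bare; PerfectScreening bets on a SIGN of ΔG (SubH) and non-saturation;
every-scale-regular/Karamata cards
ask tameness of G across scales; here the object is a normalised second difference at ONE site and
the lemma is positive-solution
asymptotics. Negatives index: only a SAW statement (stmt-0772) is refuted — no contact.

RANKED CRUXES. #2 InverseSquareLaw (crux) — (T) of the card (its T1⁺): there are κ ≥ 0, ε > 0 and C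
such that for every x ≠ 0 in ℤ³, | |x|₂² · (Δ_{ℤ³}G)(x)/G(x) − κ | ≤ C·|x|₂^{−ε}, where G =
criticalTwoPoint 3, Δ_{ℤ³} the 6-neighbour graph Laplacian and |x|₂ = √(Σx_i²) the Euclidean norm
(isotropy of κ is built into the cofinite/Euclidean formulation). Conjectural values κ = η(1+η) =
0.0376, ε = ω ≈ 0.83. [difficulty: open-problem] (why it might fail: Fails exactly when 0634 fails:
a log-periodic factor makes |x|²ΔG/G oscillate, cubic anisotropy surviving in the amplitude makes κ
direction-dependent; the Dini rate presumes a corrections-to-scaling gap ω>0; no known inequality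
controls second differences of G at β_c.) [Callen1963, KosPolandSimmonsDuffinVichi2016,
DuminilCopinICM2022 §8.1 p.25 and §8.4 p.29, DuminilCopinPanis2025LowerBounds Thm 1.5,
AizenmanDuminilCopinAnnals2021 §5–§6, ChoEtAl2022,
Summits/CriticalPhenomena/Ising3DConformalLimit/Ideas/inverse-square-telemetry.md]
#3 PositiveSolutionAsymptotics (crux) — (A), lattice Agmon–Murata–Pinchover asymptotics with Dini
rate (the card's T2, strong form): for all κ ≥ 0, ε > 0, C, all u, V : ℤ³ → ℝ and R, if u > 0 and
Δ_{ℤ³}u = V·u on {|x|₂ ≥ R}, | |x|₂²V(x) − κ | ≤ C|x|₂^{−ε} there, and u → 0 at infinity (cofinite),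
then u(x)·|x|₂^{α₊} → c for some c > 0, with α₊ = (1+√(1+4κ))/2 the decaying indicial root of α(α−1)
= κ. Applied to u = G, V = V_eff, R = 1 it turns (T) into item 0634 with 2Δ = α₊; its a-priori half
(two-sided bounds m|x|^{−α₊} ≤ u ≤ M|x|^{−α₊}, barriers r^{−α₊}(1 ∓ A r^{−ε'}) + h-transform maximum
principle) already gives HasIsingEtaBounds. [difficulty: XL] (why it might fail: Not in print on ℤ³:
the exact constant (beyond log u/log|x| → −α₊) needs a scale-uniform Harnack inequality for the
u²-conductance Laplacian on lattice annuli and lattice Taylor control of |x|^{−β}; κ=0 with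
sign-changing V needs an h-transform maximum principle; a typing slip is the live risk.)
[Murata1986, Pinchover1994, KellerPinchoverPogorzelski2018, KellerPinchoverPogorzelski2019,
KellerPogorzelski2025, Delmotte1999, LawlerLimic2010 §6.3 (Harnack) and §4.3 (Green asymptotics),
doi:10.3934/dcds.2016112]
#4 TwoPointSpineComplement (crux) — (C), the imported complement (lowest rank): for every Δ and c >
0, if G(x)·|x|₂^{2Δ} → c along the cofinite filter (the rotation-invariant pure power law, item 0634
with its witnesses exposed), then there are ρ > 0 on (0,1] and S with: 0 < Δ,
HasPointwiseScalingLimit (criticalCorr 3) ρ S, IsNondegenerateTwoPoint S, IsMoebiusCovariant Δ S,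
HasNontrivialU4 S — the conjunct with THIS Δ (ρ(δ) = δ^{−Δ} intended; n = 2 convergence, 1/2 ≤ Δ ≤
1, scale covariance and translation invariance are then automatic; what remains is n ≥ 4
existence/uniqueness, O(3) for n ≥ 3, inversion covariance, U₄ ≢ 0). The conclusion is existential,
so no coincident-configuration junk obstructs it. [difficulty: open-problem] (why it might fail: It
is the conjunct given the two-point law: n≥4 existence/uniqueness, O(3) and inversion covariance and
U₄≢0 on ℤ³ are each open (ICM 2022 §8.4); inherits ScaleCovarianceNotMoebius, LiouvilleRigidity and
IsingTrivialityFromDimensionFour unmitigated.) [DuminilCopinICM2022 §8.1 p.25 and §8.4 p.29,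
PolandRychkovVichi2019 §II eq. (2), AizenmanDuminilCopinAnnals2021 §3 eq. (U4),
Literature.Barriers.CriticalPhenomena.ScaleCovarianceNotMoebius, stmt-CriticalPhenomena-0636,
stmt-CriticalPhenomena-0637, stmt-CriticalPhenomena-0638, stmt-CriticalPhenomena-1344]
#9 PowerLawFromTelemetry (support) — The glue (T) → (A) → item 0634: instantiate (A) with u := G, V
:= Δ_{ℤ³}G/G, R := 1; positivity and u → 0 come from criticalTwoPoint_bounds_holds (c‖x‖⁻² ≤ G ≤
C‖x‖⁻¹, d = 3, proved), the equation holds by definition of V wherever G ≠ 0, the Dini bound is (T);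
conclude with Δ := α₊(κ)/2 (rewrite 2·(α₊/2) = α₊). Written fully expanded so it elaborates
stand-alone; its conclusion is verbatim IsingEuclidUpgradeR2RotInvPowerLaw. [difficulty:
provable-now] [Literature.Probability.LatticeModels.criticalTwoPoint_bounds_holds,
Literature.Probability.LatticeModels.criticalTwoPoint_bounds,
Summits/CriticalPhenomena/Ising3DConformalLimit/Ideas/inverse-square-telemetry.md]
#9 IsingEuclidUpgradeR2RotInvPowerLaw (support) — The shared milestone, item 0634 of route
IsingEuclidUpgrade, verbatim (so the ledger attaches this route to the same node): ∃ Δ, c > 0 with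
⟨σ₀σ_x⟩_{β_c(3)}·|x|₂^{2Δ} → c along the cofinite filter of ℤ³. In this route it is the OUTPUT of
InverseSquareLaw + PositiveSolutionAsymptotics (via PowerLawFromTelemetry) and the hypothesis
consumed by TwoPointSpineComplement; filed as support (unranked here) purely for cross-route
linkage. [difficulty: open-problem] [DuminilCopinICM2022 §8.1 p.25, DuminilCopinPanis2025LowerBounds
Thm 1.5, stmt-CriticalPhenomena-0634]
#9 EtaBoundsFromTelemetry (support) — Provable dividend (the a-priori half of (A) applied to G): (T)
implies two-sided power bounds with the telemetric exponent, ∃ η ≥ 0 with HasIsingEtaBounds 3 η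
(c‖x‖^{−(1+η)} ≤ G ≤ C‖x‖^{−(1+η)}, sup norm — norms are equivalent at this precision), η = α₊(κ) −
1. Proof: barriers w± = |x|₂^{−α₊}(1 ∓ A|x|₂^{−ε'}) are discrete super/sub-solutions of Δ − V far
out (lattice Taylor expansion + the Dini bound), and the maximum principle for Δ − V in
h-transformed form (h = |x|₂^{−1/2}, a strict positive supersolution since α₋ < 1/2 < α₊) compares G
with them on exterior regions; G → 0 and G > 0 from criticalTwoPoint_bounds_holds. Feeds item 0635
(∃ η, HasIsingExponentEta 3 η) through HasIsingExponentEta.of_bounded. [difficulty: L] [Fisher1967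
§5 eq. (5.5), DuminilCopinICM2022 §4.2.1 p.12,
Literature.Probability.LatticeModels.HasIsingEtaBounds,
Literature.Probability.LatticeModels.criticalTwoPoint_bounds_holds, Pinchover1994, LawlerLimic2010
§6.2 (maximum principle)]
#9 CallenIdentity (support) — Callen's identity (one-site DLR equation) for the critical plus state
on ℤ³: for x ≠ 0, ⟨σ₀σ_x⟩⁺_{β_c} = ⟨σ₀ · tanh(β_c Σ_{y∼x} σ_y)⟩⁺_{β_c}. It is the dictionary making
V_eff probe data: with tanh(β_c s) = a₁s + a₃s³ + a₅s⁵ on s ∈ {0,±2,±4,±6}, V_eff(x) = (1/a₁ − 6) −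
(a₃⟨σ₀S_x³⟩ + a₅⟨σ₀S_x⁵⟩)/(a₁⟨σ₀σ_x⟩). Provable now: the finite-volume + states on boxes satisfy it
exactly once the box contains x and its neighbours (Gibbs specification,
GibbsSpecificationDLRProofs), so the two box sequences inside plusExpect (a limUnder) are eventually
equal and have equal limUnder whether or not they converge. [difficulty: provable-now] [Callen1963,
FriedliVelenik2017 §3.3 (Gibbs specification, DLR), ChoEtAl2022 (spin-flip identities as bootstrap
constraints), Literature.Probability.LatticeModels.plusExpect]

TWO-LAYER PLAN. Foreseen glued splits (none filed now). InverseSquareLaw ⇐ RatioLimit →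
DescendantRate → InverseSquareLaw: RatioLimit = the card's T3a,
r_k(x) := ⟨σ₀S_x^k⟩/⟨σ₀σ_x⟩ → r_k^∞ for k = 3, 5 (one-odd-operator universality from current mixing
/ the IIC in d = 3: sibling card
far-field-forgets-the-probe, Panis2025 Thm 3.1, AizenmanDuminilCopinAnnals2021 §6); DescendantRate =
T3b, |x|₂²(r_k(x) − r_k^∞) → c_k
with a Dini rate, isotropically ('the first correction to a probe ratio is the Laplacian
descendant'); glue = the CallenIdentity algebra
V_eff = (1/a₁ − 6) − (a₃r₃ + a₅r₅)/a₁, κ = −(a₃c₃ + a₅c₅)/a₁. PositiveSolutionAsymptotics ⇐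
AprioriBounds → OscillationDecay →
PositiveSolutionAsymptotics: AprioriBounds = m|x|^{−α₊} ≤ u ≤ M|x|^{−α₊} eventually (barriers +
h-transform maximum principle; also the
engine of EtaBoundsFromTelemetry); OscillationDecay = the shell oscillation of u|x|^{α₊} tends to 0
(almost-monotonicity of shell maxima
and minima from the same barriers, then a scale-uniform elliptic Harnack inequality for the
u(x)u(y)-conductance Laplacian — the Doob
transform removes the potential exactly — on annuli of ℤ³, Delmotte1999-style).
TwoPointSpineComplement ⇐ (n-point tightness and
uniqueness with ρ = δ^{−Δ}) → (O(3) + inversion covariance: HyperoctahedralRP (B),(D) /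
IsingEuclidUpgrade (U′)) → (U₄ ≢ 0 = item 0636).

KILL CRITERIA. (a) InverseSquareLaw refuted — two directions (axis vs diagonal) or two scale
sequences with different limits of |x|₂²ΔG/G, or no limit,
established rigorously or made untenable by high-precision two-point data (|x| ≤ 24 suffices to see
κ ≈ 0.038 vs an O(1) anisotropy) —
closes the route `refuted:InverseSquareLaw`; the rate-free variant (T1 ⇒ η exists via log u/log|x| →
−α₊) survives only as a card note.
(b) PositiveSolutionAsymptotics refuted AS TYPED by a lattice counterexample (u, V): a typing slip —
restate 1:1 with the missing hypothesis
(the mathematics is Murata/Pinchover-standard); refuted in substance (exact constant genuinely fails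
on ℤ³ under a Dini rate) would pivot the
route to the weak pair (T1, log-asymptotics) feeding item 0635 only. (c) TwoPointSpineComplement
refuted = the conjunct fails although the
two-point law holds: kills every route to Ising3DConformalLimit as typed. (d) Item 0634 proved by
another engine moots r2/r3 for the
conjunct: close `superseded --by route-CriticalPhenomena-IsingEuclidUpgrade`, keeping
PositiveSolutionAsymptotics/EtaBoundsFromTelemetry
as wanted support statements.

NOT DECOMPOSED YET. The rate-free forms (T1: |x|²V_eff → κ only; weak Agmon: log u/log|x| → −α₊ ⇒ ∃
η, HasIsingExponentEta 3 η = item 0635) — first tenure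
addition if the Dini rate of r2 is contested; the direction-dependent variant κ(θ) (principal
eigenvalue of −Δ_{S²} + κ(θ) replaces α₊);
the screening/flux dictionary Q(R) = −ΔG(0) − Σ_{0<|x|≤R} V_eff·G = −Σ_{Λ_R}ΔG ≍ R^{−η} (discrete
divergence theorem; η > 0 ⟺ complete
screening Σ_{ℤ³}ΔG = 0) — a by-product, not load-bearing; the lattice potential-theory
infrastructure behind r3 (maximum principles on
infinite exterior sets of ℤ³, lattice Taylor remainders of |x|^{−β}, Harnack for uniformly elliptic
conductances) — provers attach these
with --supports; the interpolation coefficients a₁, a₃, a₅ of tanh(β_c s) and the probe ratios r₃,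
r₅ (layer-2 objects of the foreseen
split); any n-point work inside the complement (other routes own it).

CHEAPEST FALSIFIER. Cheapest first. (1) SOLVED-MODEL CHECK (d = 2, exact Toeplitz/Painlevé values of
the critical square-lattice two-point function):
|x|²Δ_{ℤ²}G/G for |x| ≤ 40 along (1,0) and (1,1) must tend ISOTROPICALLY to s² = (1/4)² = 1/16
(Δ_{ℝ²}r^{−s} = s²r^{−s−2}) at an
O(|x|^{−ε}) rate; direction dependence in the solved model discredits 'descendant dominance ⇒
isotropic inverse-square law' outright.
(2) d = 3 Monte Carlo (worm/cluster, β_c = 0.221654626, L = 128–256, kit job): |x|²Δ_{ℤ³}G/G for 4 ≤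
|x| ≤ 24 along (1,0,0),
(1,1,0), (1,1,1) should settle at κ = η(1+η) ≈ 0.0376 up to corrections ∝ |x|^{−0.83} and anisotropy
∝ |x|^{−2.02}; a persistent O(1)
anisotropy or a sign pattern incompatible with small κ > 0 kills r2 (ΔG/G ≈ +0.04/|x|² is a
10⁻³–10⁻⁴ effect at |x| ~ 10: needs
~10⁻⁵ relative precision on G, improved estimators). (3) Lookup for r3: if
Keller–Pinchover–Pogorzelski-type work already gives
c|x|^{−α} asymptotics for Fuchsian potentials on ℤ^d, r3 becomes `known` (good news). Not run this
session (plancard one-shot;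
galaxy/arXiv daemons saturated, see NOTES.md).

NUMBERS. β_c(3) = 0.221654626(5); Δ_σ = 0.5181489(10) ⇒ η = 0.0362978(20), κ = η(1+η) = 0.037615, α₊
= 1 + η = 1.0363 (KosPolandSimmonsDuffinVichi2016
and the 2024 bootstrap update); ω = Δ_{ε'} − 3 = 0.82968(23); leading cubic-anisotropy exponent ω₄ =
Δ_{spin-4, even} − 3 ≈ 2.02; next
ℤ₂-odd scalar Δ_{σ'} ≈ 5.2906 (descendant-dominance heuristic: level-2 descendant of σ at Δ_σ + 2 ≈
2.52 ≪ 5.29); nearest-neighbour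
correlation ⟨σ₀σ_{e₁}⟩_{β_c} ≈ 0.3302 so μ(0) = −ΔG(0) = 6(1 − G(e₁)) ≈ 4.02; rigorous window 1/2 ≤
Δ ≤ 1 (scalingDimension_mem_Icc_holds)
⇒ κ ∈ [0, 2], and η ≤ 1/2 if it exists (DuminilCopinPanis2025LowerBounds Thm 1.5) ⇒ κ ≤ 3/4; d = 2
control value κ₂ = 1/16. Items at open: 8
(3 cruxes, 4 supports, 1 assembly).

DEFINITION REQUESTS. `latticeLaplacianZd` — the 2d-neighbour graph Laplacian on Site d with the
maximum-principle / Dirichlet-problem API that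
Literature/Probability/LatticeModels/LatticeLaplacian.lean currently provides for Site 2 only (to be
filed with `ledger workitem add --kind
definition --notion latticeLaplacianZd --topic Literature/Probability/LatticeModels` for
PositiveSolutionAsymptotics; the route's statements
inline the d = 3 sum meanwhile). No cite facts needed as hypotheses: the route's import cone
contains no unproved named fact
(criticalTwoPoint_bounds_holds is a theorem).

Novelty: Searches (2026-08-15): `lit search --source crossref "positive solutions Fuchsian elliptic operators
asymptotic behavior Liouville Pinchover"`
(12: Pinchover1994, Fraas–Pinchover 2011, Giri–Pinchover 2020–23 — all continuum); `lit search
--source crossref "Keller Pinchover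
Pogorzelski criticality theory Schrödinger operators graphs optimal Hardy"` (12: KPP 2018/2019/2020,
Keller–Pogorzelski 2025 Agmon
estimates, Das–Keller–Pinchover 2025 Landis on graphs — Hardy weights/decay estimates, no c|x|^{−α}
asymptotics for inverse-square
potentials on ℤ^d); `lit search --source crossref "asymptotic behavior positive solutions discrete
Schrödinger operator lattice inverse
square potential"` (15: inverse problems and continuum multi-singular results only, e.g.
doi:10.3934/dcds.2016112); `lit frontier
CriticalPhenomena --since 2022` (30 rows: SLE/CLE, lace expansion, metric-graph GFF arm exponents,
arXiv:2604.05772 percolation in 3D Ising —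
nothing with an effective-potential or second-difference formulation of ⟨σ₀σ_x⟩_{β_c}); `ledger
negatives` (1, SAW); the card's own
searches (Murata; KPP; 'discrete Schrödinger inverse square lattice asymptotics Green'; reads of
arXiv:2404.05700 and arXiv:1912.07973:
spectral representation/gradient bounds, no ΔG/G object) and its novelty audit (refuter-6:
new-combination; nearest published use of the
same Schwinger–Dyson identities on the critical two-point function = ChoEtAl2022 as linear SDP
constraints). local `lit search`, OpenAlex,
arXiv API an  [refs: 10.3934/dcds.2016112, 10.1215/s0012-7094-86-05347-0, 10.1016/s0294-1449(16, 10.1007/s00220-018-3107-y, 2604.05772, 2404.05700, 1912.07973, 2206.12538, doi:10.3934/dcds.2016112, doi:10.1215/s0012-7094-86-05347-0, doi:10.1016/s0294-1449, doi:10.1007/s00220-018-3107-y, Pinchover1994, ChoEtAl2022, Callen1963, Murata1986, KellerPinchoverPogorzelski2018]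

Barriers (technique_class: effective-potential, positive-solution-asymptotics): - technique_class: effective-potential, positive-solution-asymptotics
- Literature.Barriers.CriticalPhenomena.LaceExpansionIsingAboveFour: evaded — no expansion about the
Gaussian point and no bubble condition; the comparison operator is −Δ + κ|x|⁻² with κ READ from the
model (κ = 0 would be the mean-field/lace world, allowed but not assumed).
- Literature.Barriers.CriticalPhenomena.IsingTrivialityFromDimensionFour: not engaged by r2/r3
(two-point statements, no U₄ claim; their d ≥ 5 analogues hold with κ = 0 and are harmless); it
applies in full to the U₄ clause inside TwoPointSpineComplement, inherited from item 0636 and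
whichever non-triviality route closes it — the bet is recorded there, not here.
- Literature.Barriers.CriticalPhenomena.LongRangeTrivialityOnZ3: not engaged by r2/r3 (no
non-Gaussianity claim); the Callen dictionary and the 6-neighbour Laplacian are
nearest-neighbour-specific objects, so nothing here is interaction-uniform; inherited by the
complement as above.
- Literature.Barriers.CriticalPhenomena.ScaleCovarianceNotMoebius: applies to the inversion clause
inside TwoPointSpineComplement only; the complement keeps the Ising hypothesis (a limit OF
criticalCorr 3 with the given two-point law) and an existential conclusion, the model-specific form
the barrier and Theorems/IsingEuclidUpgradeRefutations.lean leave open; r2/r3 make no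
covariance-upgrade claim.
- Literature.Barriers.CriticalPhenomena.LiouvilleRigidity: respected — no conformal maps, discrete
holo

History (route lifecycle, newest last):
- 2026-08-24T20:56:04Z · DORMANT — reconciler: no traction for 7.1 d (last activity item-evidence-added at 2026-08-17T18:45:47Z); parked, not closed — `ledger route dormant route-CriticalPhenomen (operator:999:2401467)
- 2026-08-29T10:32:11Z · REACTIVATED — reconciler: reactivated — activity statement-checked at 2026-08-29T09:24:49Z after parking at 2026-08-24T20:56:04Z (operator:999:2582507)

sub-problem: Ising3DConformalLimit · status: open · opened planner-plancard-CriticalPhenomena-Ising3DCon-bbf9f49f-0 2026-08-15T11:34:21Z · rev 4 · ledger route-CriticalPhenomena-InverseSquareTelemetry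
GENERATED by the gate from the ledger (D-0016/17). Provers cite these decls: `theorem foo : Summit.CriticalPhenomena.Ising3DConformalLimit.Theses.InverseSquareTelemetry.<Decl> := …` in Summits/CriticalPhenomena/Ising3DConformalLimit/Theorems/<Name>.lean.
-/

namespace Summit.CriticalPhenomena.Ising3DConformalLimit.Theses.InverseSquareTelemetry

open scoped BigOperators Topology Manifold Classical MeasureTheory ProbabilityTheory Matrix InnerProductSpace ComplexConjugate ContinuousMap
open Filter Set Function TopologicalSpace MeasureTheory

attribute [summit_statement] _root_.Ising3DConformalLimit

/-- item stmt-CriticalPhenomena-4495 · crux · rank 2 · open · by planner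
why it might fail: Fails exactly when 0634 fails: a log-periodic factor makes |x|²ΔG/G oscillate, cubic anisotropy surviving in the amplitude makes κ direction-dependent; the Dini rate presumes a corrections-to-scaling gap ω>0; no known inequality controls second differences of G at β_c.
sources: Callen1963, KosPolandSimmonsDuffinVichi2016, DuminilCopinICM2022 §8.1 p.25 and §8.4 p.29, DuminilCopinPanis2025LowerBounds Thm 1.5, AizenmanDuminilCopinAnnals2021 §5–§6, ChoEtAl2022
[crux] (T) of the card (its T1⁺): there are κ ≥ 0, ε > 0 and C such that for every x ≠ 0 in ℤ³, |
|x|₂² · (Δ_{ℤ³}G)(x)/G(x) − κ | ≤ C·|x|₂^{−ε}, where G = criticalTwoPoint 3, Δ_{ℤ³} the 6-neighbour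
graph Laplacian and |x|₂ = √(Σx_i²) the Euclidean norm (isotropy of κ is built into the
cofinite/Euclidean formulation). Conjectural values κ = η(1+η) = 0.0376, ε = ω ≈ 0.83. [difficulty:
open-problem] -/
@[route_item "route-CriticalPhenomena-InverseSquareTelemetry", crux]
def InverseSquareLaw : Prop :=
  ∃ κ ε C : ℝ, 0 ≤ κ ∧ 0 < ε ∧ ∀ x : Literature.Probability.LatticeModels.Site 3, x ≠ 0 → |(∑ i, ((x i : ℝ)) ^ 2) * (((∑ i : Fin 3, (Literature.Probability.LatticeModels.criticalTwoPoint 3 (x + Pi.single i 1) + Literature.Probability.LatticeModels.criticalTwoPoint 3 (x - Pi.single i 1))) - 6 * Literature.Probability.LatticeModels.criticalTwoPoint 3 x) / Literature.Probability.LatticeModels.criticalTwoPoint 3 x) - κ| ≤ C * Real.sqrt (∑ i, ((x i : ℝ)) ^ 2) ^ (-ε)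

/-- item stmt-CriticalPhenomena-4496 · crux · rank 3 · closed · proved by Summit.CriticalPhenomena.Ising3DConformalLimit.Theorems.positiveSolutionAsymptotics_proof @ c81700764b6c (prover) · by planner
why it might fail: Not in print on ℤ³: the exact constant (beyond log u/log|x| → −α₊) needs a scale-uniform Harnack inequality for the u²-conductance Laplacian on lattice annuli and lattice Taylor control of |x|^{−β}; κ=0 with sign-changing V needs an h-transform maximum principle; a typing slip is the live risk.
sources: Murata1986, Pinchover1994, KellerPinchoverPogorzelski2018, KellerPinchoverPogorzelski2019, KellerPogorzelski2025, Delmotte1999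
[crux] (A), lattice Agmon–Murata–Pinchover asymptotics with Dini rate (the card's T2, strong form):
for all κ ≥ 0, ε > 0, C, all u, V : ℤ³ → ℝ and R, if u > 0 and Δ_{ℤ³}u = V·u on {|x|₂ ≥ R}, |
|x|₂²V(x) − κ | ≤ C|x|₂^{−ε} there, and u → 0 at infinity (cofinite), then u(x)·|x|₂^{α₊} → c for
some c > 0, with α₊ = (1+√(1+4κ))/2 the decaying indicial root of α(α−1) = κ. Applied to u = G, V =
V_eff, R = 1 it turns (T) into item 0634 with 2Δ = α₊; its a-priori half (two-sided bounds
m|x|^{−α₊} ≤ u ≤ M|x|^{−α₊}, barriers r^{−α₊}(1 ∓ A r^{−ε'}) + h-transform maximum principle)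
already gives HasIsingEtaBounds. [difficulty: XL] -/
@[route_item "route-CriticalPhenomena-InverseSquareTelemetry", crux]
def PositiveSolutionAsymptotics : Prop :=
  ∀ κ ε C : ℝ, 0 ≤ κ → 0 < ε → ∀ (u V : Literature.Probability.LatticeModels.Site 3 → ℝ) (R : ℝ), (∀ x : Literature.Probability.LatticeModels.Site 3, R ≤ Real.sqrt (∑ i, ((x i : ℝ)) ^ 2) → 0 < u x) → (∀ x : Literature.Probability.LatticeModels.Site 3, R ≤ Real.sqrt (∑ i, ((x i : ℝ)) ^ 2) → (∑ i : Fin 3, (u (x + Pi.single i 1) + u (x - Pi.single i 1))) - 6 * u x = V x * u x) → (∀ x : Literature.Probability.LatticeModels.Site 3, R ≤ Real.sqrt (∑ i, ((x i : ℝ)) ^ 2) → |(∑ i, ((x i : ℝ)) ^ 2) * V x - κ| ≤ C * Real.sqrt (∑ i, ((x i : ℝ)) ^ 2) ^ (-ε)) → Filter.Tendsto u Filter.cofinite (nhds 0) → ∃ c : ℝ, 0 < c ∧ Filter.Tendsto (fun x : Literature.Probability.LatticeModels.Site 3 => u x * Real.sqrt (∑ i, ((x i : ℝ)) ^ 2)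 ^ ((1 + Real.sqrt (1 + 4 * κ)) / 2)) Filter.cofinite (nhds c)

-- `PositiveSolutionAsymptotics` holds: proved by `Summit.CriticalPhenomena.Ising3DConformalLimit.Theorems.positiveSolutionAsymptotics_proof` @ c81700764b6c (its module imports this route file, so no `_holds` link can be stated here).

/-- item stmt-CriticalPhenomena-4497 · crux · rank 4 · open · by planner
why it might fail: It is the conjunct given the two-point law: n≥4 existence/uniqueness, O(3) and inversion covariance and U₄≢0 on ℤ³ are each open (ICM 2022 §8.4); inherits ScaleCovarianceNotMoebius, LiouvilleRigidity and IsingTrivialityFromDimensionFour unmitigated.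
sources: DuminilCopinICM2022 §8.1 p.25 and §8.4 p.29, PolandRychkovVichi2019 §II eq. (2), AizenmanDuminilCopinAnnals2021 §3 eq. (U4), Literature.Barriers.CriticalPhenomena.ScaleCovarianceNotMoebius, stmt-CriticalPhenomena-0636, stmt-CriticalPhenomena-0637
[crux] (C), the imported complement (lowest rank): for every Δ and c > 0, if G(x)·|x|₂^{2Δ} → c
along the cofinite filter (the rotation-invariant pure power law, item 0634 with its witnesses
exposed), then there are ρ > 0 on (0,1] and S with: 0 < Δ, HasPointwiseScalingLimit (criticalCorr 3)
ρ S, IsNondegenerateTwoPoint S, IsMoebiusCovariant Δ S, HasNontrivialU4 S — the conjunct with THIS Δ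
(ρ(δ) = δ^{−Δ} intended; n = 2 convergence, 1/2 ≤ Δ ≤ 1, scale covariance and translation invariance
are then automatic; what remains is n ≥ 4 existence/uniqueness, O(3) for n ≥ 3, inversion
covariance, U₄ ≢ 0). The conclusion is existential, so no coincident-configuration junk obstructs
it. [difficulty: open-problem] -/
@[route_item "route-CriticalPhenomena-InverseSquareTelemetry", crux]
def TwoPointSpineComplement : Prop :=
  ∀ Δ c : ℝ, 0 < c → Filter.Tendsto (fun x : Literature.Probability.LatticeModels.Site 3 => Literature.Probability.LatticeModels.criticalTwoPoint 3 x * Real.sqrt (∑ i, ((x i : ℝ)) ^ 2) ^ (2 * Δ)) Filter.cofinite (nhds c) → ∃ (ρ : ℝ → ℝ) (S : Literature.Probability.LatticeModels.CorrFamily 3), (∀ δ ∈ Set.Ioc (0:ℝ) 1, 0 < ρ δ) ∧ 0 < Δ ∧ Literature.Probability.LatticeModels.HasPointwiseScalingLimit (Literature.Probability.LatticeModels.criticalCorr 3) ρ S ∧ Literature.Probability.LatticeModels.IsNondegenerateTwoPoint S ∧ Literature.Probability.LatticeModels.IsMoebiusCovariant Δ S ∧ Literature.Probability.LatticeModels.HasNontrivialU4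 S

/-- item stmt-CriticalPhenomena-0634 · support · rank 9 · open · by planner
sources: DuminilCopinICM2022 §8.1 p.25, DuminilCopinPanis2025LowerBounds Thm 1.5, stmt-CriticalPhenomena-0634
Crux r2 (hardest, most informative): the critical two-point function of the n.n. Ising model on Z^3
is asymptotically a rotation-invariant pure power law: there are Δ and c>0 with ⟨σ_0 σ_x⟩_{β_c(3)} ·
|x|_2^{2Δ} → c as |x| → ∞ (Euclidean norm, cofinite filter on Z^3). Gives existence of η = 2Δ−1,
forces ρ(δ) ≍ δ^{-Δ}, and is rotation invariance at the two-point level (open on Z^3: Duminil-Copin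
ICM2022 arXiv:2208.00864 §8; 2-D analogue for FK models: DKKMO arXiv:2012.11672). Known input:
c|x|^{-2} ≤ ⟨σ0σx⟩ ≤ C|x|^{-1} (Literature.Probability.LatticeModels.criticalTwoPoint_bounds), so Δ
∈ [1/2,1] if it exists. -/
@[route_item "route-CriticalPhenomena-InverseSquareTelemetry", crux]
def IsingEuclidUpgradeR2RotInvPowerLaw : Prop :=
  ∃ Δ c : ℝ, 0 < c ∧ Filter.Tendsto (fun x : Literature.Probability.LatticeModels.Site 3 => Literature.Probability.LatticeModels.criticalTwoPoint 3 x * Real.sqrt (∑ i, ((x i : ℝ)) ^ 2) ^ (2 * Δ)) Filter.cofinite (nhds c)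

/-- item stmt-CriticalPhenomena-4498 · support · rank 9 · closed · proved by Summit.CriticalPhenomena.Ising3DConformalLimit.Theorems.powerLawFromTelemetry_proof @ d8ffd23b2405 (prover) · by planner
sources: Literature.Probability.LatticeModels.criticalTwoPoint_bounds_holds, Literature.Probability.LatticeModels.criticalTwoPoint_bounds, Summits/CriticalPhenomena/Ising3DConformalLimit/Ideas/inverse-square-telemetry.md
[support] The glue (T) → (A) → item 0634: instantiate (A) with u := G, V := Δ_{ℤ³}G/G, R := 1;
positivity and u → 0 come from criticalTwoPoint_bounds_holds (c‖x‖⁻² ≤ G ≤ C‖x‖⁻¹, d = 3, proved),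
the equation holds by definition of V wherever G ≠ 0, the Dini bound is (T); conclude with Δ :=
α₊(κ)/2 (rewrite 2·(α₊/2) = α₊). Written fully expanded so it elaborates stand-alone; its conclusion
is verbatim IsingEuclidUpgradeR2RotInvPowerLaw. [difficulty: provable-now] -/
@[route_item "route-CriticalPhenomena-InverseSquareTelemetry", crux]
def PowerLawFromTelemetry : Prop :=
  (∃ κ ε C : ℝ, 0 ≤ κ ∧ 0 < ε ∧ ∀ x : Literature.Probability.LatticeModels.Site 3, x ≠ 0 → |(∑ i, ((x i : ℝ)) ^ 2) * (((∑ i : Fin 3, (Literature.Probability.LatticeModels.criticalTwoPoint 3 (x + Pi.single i 1) + Literature.Probability.LatticeModels.criticalTwoPoint 3 (x - Pi.single i 1))) - 6 * Literature.Probability.LatticeModels.criticalTwoPoint 3 x) / Literature.Probability.LatticeModels.criticalTwoPoint 3 x) - κ| ≤ C * Real.sqrt (∑ i, ((x i : ℝ)) ^ 2) ^ (-ε)) → (∀ κ ε C : ℝ, 0 ≤ κ → 0 < ε → ∀ (u V : Literature.Probability.LatticeModels.Site 3 → ℝ) (R : ℝ), (∀ x : Literature.Probability.LatticeModels.Site 3,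 R ≤ Real.sqrt (∑ i, ((x i : ℝ)) ^ 2) → 0 < u x) → (∀ x : Literature.Probability.LatticeModels.Site 3, R ≤ Real.sqrt (∑ i, ((x i : ℝ)) ^ 2) → (∑ i : Fin 3, (u (x + Pi.single i 1) + u (x - Pi.single i 1))) - 6 * u x = V x * u x) → (∀ x : Literature.Probability.LatticeModels.Site 3, R ≤ Real.sqrt (∑ i, ((x i : ℝ)) ^ 2) → |(∑ i, ((x i : ℝ)) ^ 2) * V x - κ| ≤ C * Real.sqrt (∑ i, ((x i : ℝ)) ^ 2) ^ (-ε)) → Filter.Tendsto u Filter.cofinite (nhds 0) → ∃ c : ℝ, 0 < c ∧ Filter.Tendsto (fun x : Literature.Probability.LatticeModels.Site 3 => u x * Real.sqrt (∑ i, ((x i : ℝ)) ^ 2) ^ ((1 + Real.sqrt (1 + 4 * κ)) / 2)) Filter.cofinite (nhds c)) → ∃ Δ c : ℝ, 0 < c ∧ Filter.Tendsto (fun x : Literature.Probability.LatticeModels.Site 3 => Literature.Probability.LatticeModels.criticalTwoPoint 3 x * Real.sqrt (∑ i, ((x i : ℝ)) ^ 2) ^ (2 * Δ)) Filter.cofinite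 (nhds c)

-- `PowerLawFromTelemetry` holds: proved by `Summit.CriticalPhenomena.Ising3DConformalLimit.Theorems.powerLawFromTelemetry_proof` @ d8ffd23b2405 (its module imports this route file, so no `_holds` link can be stated here).

/-- item stmt-CriticalPhenomena-4499 · support · rank 9 · closed · proved by Summit.CriticalPhenomena.Ising3DConformalLimit.Theorems.etaBoundsFromTelemetry_proof @ 2d9b2ef7cbfa (prover) · by planner
sources: Fisher1967 §5 eq. (5.5), DuminilCopinICM2022 §4.2.1 p.12, Literature.Probability.LatticeModels.HasIsingEtaBounds, Literature.Probability.LatticeModels.criticalTwoPoint_bounds_holds, Pinchover1994, LawlerLimic2010 §6.2 (maximum principle)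
[support] Provable dividend (the a-priori half of (A) applied to G): (T) implies two-sided power
bounds with the telemetric exponent, ∃ η ≥ 0 with HasIsingEtaBounds 3 η (c‖x‖^{−(1+η)} ≤ G ≤
C‖x‖^{−(1+η)}, sup norm — norms are equivalent at this precision), η = α₊(κ) − 1. Proof: barriers w±
= |x|₂^{−α₊}(1 ∓ A|x|₂^{−ε'}) are discrete super/sub-solutions of Δ − V far out (lattice Taylor
expansion + the Dini bound), and the maximum principle for Δ − V in h-transformed form (h =
|x|₂^{−1/2}, a strict positive supersolution since α₋ < 1/2 < α₊) compares G with them on exterior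
regions; G → 0 and G > 0 from criticalTwoPoint_bounds_holds. Feeds item 0635 (∃ η,
HasIsingExponentEta 3 η) through HasIsingExponentEta.of_bounded. [difficulty: L] -/
@[route_item "route-CriticalPhenomena-InverseSquareTelemetry", crux]
def EtaBoundsFromTelemetry : Prop :=
  (∃ κ ε C : ℝ, 0 ≤ κ ∧ 0 < ε ∧ ∀ x : Literature.Probability.LatticeModels.Site 3, x ≠ 0 → |(∑ i, ((x i : ℝ)) ^ 2) * (((∑ i : Fin 3, (Literature.Probability.LatticeModels.criticalTwoPoint 3 (x + Pi.single i 1) + Literature.Probability.LatticeModels.criticalTwoPoint 3 (x - Pi.single i 1))) - 6 * Literature.Probability.LatticeModels.criticalTwoPoint 3 x) / Literature.Probability.LatticeModels.criticalTwoPoint 3 x) - κ| ≤ C * Real.sqrt (∑ i, ((x i : ℝ)) ^ 2) ^ (-ε)) → ∃ η : ℝ, 0 ≤ η ∧ Literature.Probability.LatticeModels.HasIsingEtaBounds 3 η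

-- `EtaBoundsFromTelemetry` holds: proved by `Summit.CriticalPhenomena.Ising3DConformalLimit.Theorems.etaBoundsFromTelemetry_proof` @ 2d9b2ef7cbfa (its module imports this route file, so no `_holds` link can be stated here).

/-- item stmt-CriticalPhenomena-4500 · support · rank 9 · closed · proved by Summit.CriticalPhenomena.Ising3DConformalLimit.Theorems.CallenIdentity_proof @ 9601316729d7 (prover) · by planner
sources: Callen1963, FriedliVelenik2017 §3.3 (Gibbs specification; DLR equations), ChoEtAl2022 (spin-flip identities as bootstrap constraints), Literature.Probability.LatticeModels.plusExpect
[support] Callen's identity (one-site DLR equation) for the critical plus state on ℤ³: for x ≠ 0,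
⟨σ₀σ_x⟩⁺_{β_c} = ⟨σ₀ · tanh(β_c Σ_{y∼x} σ_y)⟩⁺_{β_c}. It is the dictionary making V_eff probe data:
with tanh(β_c s) = a₁s + a₃s³ + a₅s⁵ on s ∈ {0,±2,±4,±6}, V_eff(x) = (1/a₁ − 6) − (a₃⟨σ₀S_x³⟩ +
a₅⟨σ₀S_x⁵⟩)/(a₁⟨σ₀σ_x⟩). Provable now: the finite-volume + states on boxes satisfy it exactly once
the box contains x and its neighbours (Gibbs specification, GibbsSpecificationDLRProofs), so the two
box sequences inside plusExpect (a limUnder) are eventually equal and have equal limUnder whether or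
not they converge. [difficulty: provable-now] -/
@[route_item "route-CriticalPhenomena-InverseSquareTelemetry", crux]
def CallenIdentity : Prop :=
  ∀ x : Literature.Probability.LatticeModels.Site 3, x ≠ 0 → Literature.Probability.LatticeModels.criticalTwoPoint 3 x = Literature.Probability.LatticeModels.plusExpect 3 (Literature.Probability.LatticeModels.criticalBeta 3) 0 (fun s => Literature.Probability.LatticeModels.spinAt 0 s * Real.tanh (Literature.Probability.LatticeModels.criticalBeta 3 * ∑ i : Fin 3, (Literature.Probability.LatticeModels.spinAt (x + Pi.single i 1) s + Literature.Probability.LatticeModels.spinAt (x - Pi.single i 1) s)))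

-- `CallenIdentity` holds: proved by `Summit.CriticalPhenomena.Ising3DConformalLimit.Theorems.CallenIdentity_proof` @ 9601316729d7 (its module imports this route file, so no `_holds` link can be stated here).

/-- item stmt-CriticalPhenomena-4501 · assembly · rank 1 · closed · proved by Summit.CriticalPhenomena.Ising3DConformalLimit.Theorems.inverseSquareTelemetry_assembly_proof @ fd3a35a9dcea (prover) · by planner
sources: Summits/CriticalPhenomena/Ising3DConformalLimit/Ideas/inverse-square-telemetry.md, DuminilCopinICM2022 §8.1
[assembly] InverseSquareLaw → PositiveSolutionAsymptotics → PowerLawFromTelemetry →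
TwoPointSpineComplement → Ising3DConformalLimit. -/
@[route_item "route-CriticalPhenomena-InverseSquareTelemetry", crux]
def Assembly : Prop :=
  InverseSquareLaw → PositiveSolutionAsymptotics → PowerLawFromTelemetry → TwoPointSpineComplement → Ising3DConformalLimit

-- `Assembly` holds: proved by `Summit.CriticalPhenomena.Ising3DConformalLimit.Theorems.inverseSquareTelemetry_assembly_proof` @ fd3a35a9dcea (its module imports this route file, so no `_holds` link can be stated here).

/-! D-0027 §2.1 — DECIDING THEOREM (planner-authored via `route open/edit --closes-file`; by operator:999:2941348 2026-08-15T15:23:11Z):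
its hypotheses are this route's items and its conclusion the sub-problem Statement (glue_lint), and it elaborates with this file. -/

@[closes "route-CriticalPhenomena-InverseSquareTelemetry"] theorem closes : InverseSquareLaw → PositiveSolutionAsymptotics → TwoPointSpineComplement → IsingEuclidUpgradeR2RotInvPowerLaw → PowerLawFromTelemetry → EtaBoundsFromTelemetry → CallenIdentity → Assembly → _root_.Ising3DConformalLimit := fun h_InverseSquareLaw h_PositiveSolutionAsymptotics h_TwoPointSpineComplement h_IsingEuclidUpgradeR2RotInvPowerLaw h_PowerLawFromTelemetry h_EtaBoundsFromTelemetry h_CallenIdentity h_Assembly => h_Assembly h_InverseSquareLaw h_PositiveSolutionAsymptotics h_PowerLawFromTelemetry h_TwoPointSpineComplement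

end Summit.CriticalPhenomena.Ising3DConformalLimit.Theses.InverseSquareTelemetry
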